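import Summits.CriticalPhenomena.PercolationContinuityZ3.Theorems.PercNearOneGluingNoHeavyLowerTailKnQuestion8CoefficientwiseRootSetKernelRowTwoCoreNonAdj
import HarnessLib

/-!
# The root-set kernel: ROW 2 of RCSET with `q ≁ y` — prim-lf-2 gen 60

Support file (`--supports stmt-CriticalPhenomena-4575`, closed), prover `prim-lf-2` (gen 60).  No definitions, no named facts, no sorries; standard axioms.
Memo `prim-lf-2/CW-KERNEL-gen59.md` §6.7; companions `…RootSetKernelRowTwoCoreNonAdj.lean` (the combinatorial core `rcset_row_two_core_nonadj`),
`…RootSetKernelRowTwo.lean` (the case `q ∼ y`, `rcset_row_two`), `…RootSetKernelRowTwoPrep.lean` (set-cluster primitives, `sum_powerset_union_of_disjoint`).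

THE ROOT-SET KERNEL (memo CW-IGCEX-gen58 §8b).  Multigraph `ends : ι → Sym2 V`, edge set `E`, target `y`; `R_A(t) = {v | ∃ a ∈ A, v ∈ C_a(t)}` (red cluster of the SET `A`),
`B_A(t) = R_A(E ∖ t)`, `Φ(A, A') = Σ_{t ⊆ E : ¬(y ∈ R_A(t) ∧ y ∈ B_{A'}(t))} (f R_A(t) − f B_{A'}(t))·(g R_A(t) − g B_{A'}(t))`.
CONJECTURE RCSET (prim-lf-2 gen 58): `Φ(S',S') ≤ 2·Φ(S,S')` for nested root sets `S ⊆ S' ∌ y`.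
* `Coefficientwise.setCluster_union_eq_of_not_mem` — EXPLORATION LEMMA: if every edge of `β` has `y` as an end and `y ∉ R_A(t ∪ β)`, then `R_A(t ∪ β) = R_A(t)`
  (red edges at an unreached vertex are never used).
* `Coefficientwise.rcset_row_two_nonadj` — **THEOREM: ROW 2 of RCSET when `q ≁ y`.**  For finite `V`, `y ≠ q`, `U = V ∖ {y,q}`, a root set `S` with `y, q ∉ S`,
  monotone `f, g`, provided `U ∼ y` and `U ∼ q` in `E` and NO edge of `E` joins `q` to `y`:  `Φ(U,U) ≤ 2·Φ(S,U)`.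
  Together with `rcset_row_two` (`q ∼ y`) this is ROW 2 for every multigraph in which both outer vertices are attached to `U`.
Proof (memo §6.7).  Split every colouring as `t = τ ∪ ω` (`ω ⊆ Out = Aq ∪ By`, the `U–q` and `U–y` edges; `sum_powerset_union_of_disjoint`), fix `τ`, and show the
raw slice inequality `0 ≤ Σ_{ω ⊆ Out} [2·adm_S T_S(τ∪ω) − adm_U T_U(τ∪ω)]`: the maps `ω ↦ R_S(τ∪ω), R_U(τ∪ω), B_U(τ∪ω)` satisfy the axioms of `rcset_row_two_core_nonadj`
(with no `q–y` edge, `y ∈ B_U` iff a `U–y` edge is blue, etc.; the exploration axiom is `setCluster_union_eq_of_not_mem`).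
(Decidability instances on `ι` are the classical ones, as in `rcset_row_two`.)
[cite: KozmaNitzan2024, Questions 8–9 (§5.5 p. 36) (context: the Question-8 pocket covariance programme)]
-/

namespace Summit.CriticalPhenomena.PercolationContinuityZ3.Theorems

open Finset Literature.Probability.Percolation

namespace Coefficientwise

variable {ι V : Type*}

/-- **Exploration lemma.**  If every edge of `β` has `y` as an end and `y` is not in the red cluster `R_A(t ∪ β)`, then `R_A(t ∪ β) = R_A(t)`:
the red edges at an unreached vertex are never used. [folklore] -/
theorem setCluster_union_eq_of_not_mem [DecidableEq ι] (ends : ι → Sym2 V) (A : Finset V) {t β : Finset ι} {y : V}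
    (hβ : ∀ j ∈ β, ∃ u : V, ends j = s(u, y))
    (hy : y ∉ {v | ∃ a ∈ A, v ∈ openCluster (ends '' (↑(t ∪ β) : Set ι)) a}) :
    {v | ∃ a ∈ A, v ∈ openCluster (ends '' (↑(t ∪ β) : Set ι)) a} = {v | ∃ a ∈ A, v ∈ openCluster (ends '' (↑t : Set ι)) a} := by
  refine Set.Subset.antisymm ?_ (setCluster_mono ends A Finset.subset_union_left)
  set R' : Set V := {v | ∃ a ∈ A, v ∈ openCluster (ends '' (↑(t ∪ β) : Set ι)) a} with hR'
  set R : Set V := {v | ∃ a ∈ A, v ∈ openCluster (ends '' (↑t : Set ι)) a} with hR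
  -- `R ∪ R'ᶜ` contains `A` and is closed under the red edges `t ∪ β`
  have hcl : R' ⊆ R ∪ R'ᶜ := by
    refine setCluster_subset_of_closed ends (W := R ∪ R'ᶜ) (fun a ha => Or.inl (subset_setCluster ends A t ha)) ?_
    intro i hi u w huw hu
    rcases hu with hu | hu
    · rcases Finset.mem_union.mp hi with hit | hiβ
      · exact Or.inl (setCluster_step ends A hit huw hu)
      · obtain ⟨u', hu'⟩ := hβ i hiβ
        rw [huw] at hu'
        rcases Sym2.eq_iff.mp hu' with ⟨_, hw⟩ | ⟨huy, _⟩
        · refine Or.inr ?_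
          rw [hw]; exact hy
        · exact absurd (setCluster_mono ends A Finset.subset_union_left (huy ▸ hu)) hy
    · exact Or.inr fun hw => hu (setCluster_step ends A hi (by rw [huw, Sym2.eq_swap]) hw)
  intro v hv
  rcases hcl hv with h | h
  · exact h
  · exact absurd hv h

open Classical in
/-- **Row 2 of RCSET with `q ≁ y`** (see the module docstring): for finite `V`, `y ≠ q`, `U = V ∖ {y, q}`, `y, q ∉ S`, monotone `f, g`, an edge of each kind `U–q`, `U–y`
in `E`, and no `q–y` edge in `E`:  `Φ(U,U) ≤ 2·Φ(S,U)` for the root-set kernel `Φ` of `(ends, E, y, f, g)`. [cite: KozmaNitzan2024, Questions 8–9 (§5.5 p. 36) (context)] -/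
theorem rcset_row_two_nonadj [Fintype V] [DecidableEq V] (ends : ι → Sym2 V) (E : Finset ι) (y q : V) (hyq : y ≠ q) (S : Finset V) (hyS : y ∉ S) (hqS : q ∉ S)
    (hAq : ∃ i ∈ E, ∃ u : V, u ≠ q ∧ u ≠ y ∧ ends i = s(u, q)) (hBy : ∃ i ∈ E, ∃ u : V, u ≠ q ∧ u ≠ y ∧ ends i = s(u, y))
    (hnCq : ∀ i ∈ E, ends i ≠ s(q, y))
    (f g : Set V → ℝ) (hf : Monotone f) (hg : Monotone g) :
    (∑ s ∈ E.powerset.filter (fun s : Finset ι =>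
          ¬ ((∃ a ∈ ((Finset.univ : Finset V).erase y).erase q, y ∈ openCluster (ends '' (↑s : Set ι)) a) ∧
             (∃ a ∈ ((Finset.univ : Finset V).erase y).erase q, y ∈ openCluster (ends '' (↑(E \ s) : Set ι)) a))),
        (f {v | ∃ a ∈ ((Finset.univ : Finset V).erase y).erase q, v ∈ openCluster (ends '' (↑s : Set ι)) a} -
            f {v | ∃ a ∈ ((Finset.univ : Finset V).erase y).erase q, v ∈ openCluster (ends '' (↑(E \ s) : Set ι)) a}) *
          (g {v | ∃ a ∈ ((Finset.univ : Finset V).erase y).erase q, v ∈ openCluster (ends '' (↑s : Set ι)) a} -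
            g {v | ∃ a ∈ ((Finset.univ : Finset V).erase y).erase q, v ∈ openCluster (ends '' (↑(E \ s) : Set ι)) a})) ≤
    2 * ∑ s ∈ E.powerset.filter (fun s : Finset ι =>
          ¬ ((∃ a ∈ S, y ∈ openCluster (ends '' (↑s : Set ι)) a) ∧
             (∃ a ∈ ((Finset.univ : Finset V).erase y).erase q, y ∈ openCluster (ends '' (↑(E \ s) : Set ι)) a))),
        (f {v | ∃ a ∈ S, v ∈ openCluster (ends '' (↑s : Set ι)) a} -
            f {v | ∃ a ∈ ((Finset.univ : Finset V).erase y).erase q, v ∈ openCluster (ends '' (↑(E \ s) : Set ι)) a}) *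
          (g {v | ∃ a ∈ S, v ∈ openCluster (ends '' (↑s : Set ι)) a} -
            g {v | ∃ a ∈ ((Finset.univ : Finset V).erase y).erase q, v ∈ openCluster (ends '' (↑(E \ s) : Set ι)) a}) := by
  -- notation
  set U : Finset V := ((Finset.univ : Finset V).erase y).erase q with hU
  set RU : Finset ι → Set V := fun t => {v | ∃ a ∈ U, v ∈ openCluster (ends '' (↑t : Set ι)) a} with hRU
  set RS : Finset ι → Set V := fun t => {v | ∃ a ∈ S, v ∈ openCluster (ends '' (↑t : Set ι)) a} with hRS
  set admU : Finset ι → Prop := fun s => ¬ ((∃ a ∈ U, y ∈ openCluster (ends '' (↑s : Set ι)) a) ∧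
      (∃ a ∈ U, y ∈ openCluster (ends '' (↑(E \ s) : Set ι)) a)) with hadmU
  set admS : Finset ι → Prop := fun s => ¬ ((∃ a ∈ S, y ∈ openCluster (ends '' (↑s : Set ι)) a) ∧
      (∃ a ∈ U, y ∈ openCluster (ends '' (↑(E \ s) : Set ι)) a)) with hadmS
  set TU : Finset ι → ℝ := fun s => (f (RU s) - f (RU (E \ s))) * (g (RU s) - g (RU (E \ s))) with hTU
  set TS : Finset ι → ℝ := fun s => (f (RS s) - f (RU (E \ s))) * (g (RS s) - g (RU (E \ s))) with hTS
  change ∑ s ∈ E.powerset.filter admU, TU s ≤ 2 * ∑ s ∈ E.powerset.filter admS, TS s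
  /- ### vertices -/
  have hyU : y ∉ U := fun h => (Finset.mem_erase.mp (Finset.mem_erase.mp h).2).1 rfl
  have hqU : q ∉ U := fun h => (Finset.mem_erase.mp h).1 rfl
  have memU : ∀ v : V, v ≠ q → v ≠ y → v ∈ U := fun v h1 h2 => Finset.mem_erase.mpr ⟨h1, Finset.mem_erase.mpr ⟨h2, Finset.mem_univ v⟩⟩
  have hSU : (↑S : Set V) ⊆ ↑U := by
    intro v hv
    have hv' := Finset.mem_coe.mp hv
    exact Finset.mem_coe.mpr (memU v (fun h => hqS (h ▸ hv')) (fun h => hyS (h ▸ hv')))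
  have hUsubRU : ∀ t, (↑U : Set V) ⊆ RU t := fun t => subset_setCluster ends U t
  /- ### edge classes -/
  set Aq : Finset ι := E.filter (fun i => ∃ u : V, u ≠ q ∧ u ≠ y ∧ ends i = s(u, q)) with hAqdef
  set By : Finset ι := E.filter (fun i => ∃ u : V, u ≠ q ∧ u ≠ y ∧ ends i = s(u, y)) with hBydef
  set Out : Finset ι := Aq ∪ By with hOut
  set E' : Finset ι := E \ Out with hE'
  have hAqE : Aq ⊆ E := Finset.filter_subset _ E
  have hByE : By ⊆ E := Finset.filter_subset _ E
  have hOutE : Out ⊆ E := Finset.union_subset hAqE hByE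
  have hAqOut : Aq ⊆ Out := Finset.subset_union_left
  have hByOut : By ⊆ Out := Finset.subset_union_right
  have hAqne : Aq.Nonempty := by
    obtain ⟨i, hi, u, h1, h2, h3⟩ := hAq; exact ⟨i, Finset.mem_filter.mpr ⟨hi, u, h1, h2, h3⟩⟩
  have hByne : By.Nonempty := by
    obtain ⟨i, hi, u, h1, h2, h3⟩ := hBy; exact ⟨i, Finset.mem_filter.mpr ⟨hi, u, h1, h2, h3⟩⟩
  -- ends of the classified edges
  have endsAq : ∀ i ∈ Aq, ∃ u : V, u ∈ U ∧ ends i = s(u, q) := by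
    intro i hi; obtain ⟨_, u, h1, h2, h3⟩ := Finset.mem_filter.mp hi; exact ⟨u, memU u h1 h2, h3⟩
  have endsBy : ∀ i ∈ By, ∃ u : V, u ∈ U ∧ ends i = s(u, y) := by
    intro i hi; obtain ⟨_, u, h1, h2, h3⟩ := Finset.mem_filter.mp hi; exact ⟨u, memU u h1 h2, h3⟩
  -- disjointness
  have hAqBy : ∀ i, i ∈ Aq → i ∉ By := by
    intro i hi hi'
    obtain ⟨u, hu, h⟩ := endsAq i hi; obtain ⟨u', hu', h'⟩ := endsBy i hi'
    rw [h] at h'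
    rcases Sym2.eq_iff.mp h' with ⟨_, h2⟩ | ⟨h1, _⟩
    · exact hyq h2.symm
    · exact hyU (h1 ▸ hu)
  have hdisj : Disjoint Aq By := Finset.disjoint_left.mpr (fun i hi => hAqBy i hi)
  -- with no `q–y` edge, every non-loop edge of `E` at `y` (resp. `q`) is a `By` (resp. `Aq`) edge
  have at_y : ∀ i ∈ E, ∀ w : V, w ≠ y → ends i = s(w, y) → i ∈ By := by
    intro i hi w hwy h
    by_cases hwq : w = q
    · exact absurd (by rw [h, hwq]) (hnCq i hi)
    · exact Finset.mem_filter.mpr ⟨hi, w, hwq, hwy, h⟩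
  have at_q : ∀ i ∈ E, ∀ w : V, w ≠ q → ends i = s(w, q) → i ∈ Aq := by
    intro i hi w hwq h
    by_cases hwy : w = y
    · exact absurd (by rw [h, hwy, Sym2.eq_swap]) (hnCq i hi)
    · exact Finset.mem_filter.mpr ⟨hi, w, hwq, hwy, h⟩
  -- closure of `U` under the unclassified edges
  have closedU : ∀ i ∈ E, i ∉ Aq → i ∉ By → ∀ u w : V, ends i = s(u, w) → u ∈ (↑U : Set V) → w ∈ (↑U : Set V) := by
    intro i hi hiA hiB u w h hu
    have hu' := Finset.mem_coe.mp hu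
    have huq : u ≠ q := fun e => hqU (e ▸ hu')
    have huy : u ≠ y := fun e => hyU (e ▸ hu')
    by_cases hwq : w = q
    · exact absurd (Finset.mem_filter.mpr ⟨hi, u, huq, huy, by rw [h, hwq]⟩) hiA
    by_cases hwy : w = y
    · exact absurd (Finset.mem_filter.mpr ⟨hi, u, huq, huy, by rw [h, hwy]⟩) hiB
    exact Finset.mem_coe.mpr (memU w hwq hwy)
  /- ### cluster facts for colourings `t ⊆ E` -/
  -- (a) no `Aq`/`By` edge: the clusters of `S` and of `U` stay inside `U`
  have RS_sub_U : ∀ t : Finset ι, t ⊆ E → (∀ i ∈ t, i ∉ Aq) → (∀ i ∈ t, i ∉ By) → RS t ⊆ ↑U :=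
    fun t ht hA hB => setCluster_subset_of_closed ends hSU (fun i hi u w h hu => closedU i (ht hi) (hA i hi) (hB i hi) u w h hu)
  have RU_sub_U : ∀ t : Finset ι, t ⊆ E → (∀ i ∈ t, i ∉ Aq) → (∀ i ∈ t, i ∉ By) → RU t ⊆ ↑U :=
    fun t ht hA hB => setCluster_subset_of_closed ends subset_rfl (fun i hi u w h hu => closedU i (ht hi) (hA i hi) (hB i hi) u w h hu)
  -- (b) no `By` edge: `y` is not reached; no `Aq` edge: `q` is not reached
  have y_notin_RS : ∀ t : Finset ι, t ⊆ E → (∀ i ∈ t, i ∉ By) → y ∉ RS t := fun t ht hB =>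
    not_mem_setCluster_of_isolated ends hyS fun i hi w hwy h => hB i hi (at_y i (ht hi) w hwy h)
  have y_notin_RU : ∀ t : Finset ι, t ⊆ E → (∀ i ∈ t, i ∉ By) → y ∉ RU t := fun t ht hB =>
    not_mem_setCluster_of_isolated ends hyU fun i hi w hwy h => hB i hi (at_y i (ht hi) w hwy h)
  have q_notin_RS : ∀ t : Finset ι, t ⊆ E → (∀ i ∈ t, i ∉ Aq) → q ∉ RS t := fun t ht hA =>
    not_mem_setCluster_of_isolated ends hqS fun i hi w hwq h => hA i hi (at_q i (ht hi) w hwq h)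
  have q_notin_RU : ∀ t : Finset ι, t ⊆ E → (∀ i ∈ t, i ∉ Aq) → q ∉ RU t := fun t ht hA =>
    not_mem_setCluster_of_isolated ends hqU fun i hi w hwq h => hA i hi (at_q i (ht hi) w hwq h)
  -- (c) direct reaches
  have y_in_RU : ∀ t : Finset ι, (∃ j ∈ By, j ∈ t) → y ∈ RU t := by
    rintro t ⟨j, hj, hjt⟩
    obtain ⟨u, hu, h⟩ := endsBy j hj
    exact setCluster_step ends U hjt h (hUsubRU t (Finset.mem_coe.mpr hu))
  have q_in_RU : ∀ t : Finset ι, (∃ i ∈ Aq, i ∈ t) → q ∈ RU t := by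
    rintro t ⟨i, hi, hit⟩
    obtain ⟨u, hu, h⟩ := endsAq i hi
    exact setCluster_step ends U hit h (hUsubRU t (Finset.mem_coe.mpr hu))
  /- ### decomposition `E = E' ∪ Out` and reduction to a fixed inner colouring `τ` -/
  have hdisjE : Disjoint E' Out := Finset.sdiff_disjoint
  have hEE : E' ∪ Out = E := Finset.sdiff_union_of_subset hOutE
  rw [Finset.sum_filter, Finset.sum_filter]
  rw [show (∑ s ∈ E.powerset, if admU s then TU s else 0) =
      ∑ τ ∈ E'.powerset, ∑ ω ∈ Out.powerset, (if admU (τ ∪ ω) then TU (τ ∪ ω) else 0) by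
    rw [← sum_powerset_union_of_disjoint E' Out hdisjE (fun s => if admU s then TU s else 0), hEE]]
  rw [show (∑ s ∈ E.powerset, if admS s then TS s else 0) =
      ∑ τ ∈ E'.powerset, ∑ ω ∈ Out.powerset, (if admS (τ ∪ ω) then TS (τ ∪ ω) else 0) by
    rw [← sum_powerset_union_of_disjoint E' Out hdisjE (fun s => if admS s then TS s else 0), hEE]]
  rw [Finset.mul_sum]
  refine Finset.sum_le_sum fun τ hτ => ?_
  have hτE' : τ ⊆ E' := Finset.mem_powerset.mp hτ
  have hτE : τ ⊆ E := hτE'.trans Finset.sdiff_subset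
  have hτOut : ∀ i ∈ τ, i ∉ Out := fun i hi => (Finset.mem_sdiff.mp (hτE' hi)).2
  have hτAq : ∀ i ∈ τ, i ∉ Aq := fun i hi h => hτOut i hi (hAqOut h)
  have hτBy : ∀ i ∈ τ, i ∉ By := fun i hi h => hτOut i hi (hByOut h)
  rw [Finset.mul_sum, ← sub_nonneg, ← Finset.sum_sub_distrib]
  /- ### the slice at `τ`: instantiate the combinatorial core with `ω ↦ R_S(τ ∪ ω∩Out), R_U(τ ∪ ω∩Out), B_U(τ ∪ ω∩Out)` -/
  have sE : ∀ ω : Finset ι, τ ∪ ω ∩ Out ⊆ E := fun ω => Finset.union_subset hτE (Finset.inter_subset_right.trans hOutE)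
  -- an `Out`-edge is blue iff it is not in `ω`
  have blue_iff : ∀ ω : Finset ι, ∀ i ∈ Out, (i ∈ E \ (τ ∪ ω ∩ Out) ↔ i ∉ ω) := by
    intro ω i hi
    rw [Finset.mem_sdiff, Finset.mem_union, Finset.mem_inter]
    constructor
    · rintro ⟨_, h⟩ hiω; exact h (Or.inr ⟨hiω, hi⟩)
    · intro hiω; refine ⟨hOutE hi, ?_⟩
      rintro (h | ⟨h, _⟩)
      · exact hτOut i h hi
      · exact hiω h
  -- a red `Out`-edge of `τ ∪ ω∩Out` lies in `ω`
  have red_imp : ∀ ω : Finset ι, ∀ i ∈ τ ∪ ω ∩ Out, i ∈ Out → i ∈ ω := by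
    intro ω i hi hiO
    rcases Finset.mem_union.mp hi with h | h
    · exact absurd hiO (hτOut i h)
    · exact (Finset.mem_inter.mp h).1
  have hyB : ∀ ω : Finset ι, y ∈ RU (E \ (τ ∪ ω ∩ Out)) ↔ ∃ j ∈ By, j ∉ ω := by
    intro ω
    constructor
    · intro hy
      by_contra hne
      refine y_notin_RU _ Finset.sdiff_subset (fun i hi hiB => ?_) hy
      exact hne ⟨i, hiB, (blue_iff ω i (hByOut hiB)).mp hi⟩
    · rintro ⟨j, hj, hjω⟩
      exact y_in_RU _ ⟨j, hj, (blue_iff ω j (hByOut hj)).mpr hjω⟩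
  have hqB : ∀ ω : Finset ι, q ∈ RU (E \ (τ ∪ ω ∩ Out)) ↔ ∃ i ∈ Aq, i ∉ ω := by
    intro ω
    constructor
    · intro hq
      by_contra hne
      refine q_notin_RU _ Finset.sdiff_subset (fun i hi hiA => ?_) hq
      exact hne ⟨i, hiA, (blue_iff ω i (hAqOut hiA)).mp hi⟩
    · rintro ⟨i, hi, hiω⟩
      exact q_in_RU _ ⟨i, hi, (blue_iff ω i (hAqOut hi)).mpr hiω⟩
  have hyP : ∀ ω : Finset ι, y ∈ RU (τ ∪ ω ∩ Out) ↔ ∃ j ∈ By, j ∈ ω := by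
    intro ω
    constructor
    · intro hy
      by_contra hne
      refine y_notin_RU _ (sE ω) (fun i hi hiB => ?_) hy
      exact hne ⟨i, hiB, red_imp ω i hi (hByOut hiB)⟩
    · rintro ⟨j, hj, hjω⟩
      exact y_in_RU _ ⟨j, hj, Finset.mem_union_right _ (Finset.mem_inter.mpr ⟨hjω, hByOut hj⟩)⟩
  have hqP : ∀ ω : Finset ι, q ∈ RU (τ ∪ ω ∩ Out) ↔ ∃ i ∈ Aq, i ∈ ω := by
    intro ω
    constructor
    · intro hq
      by_contra hne
      refine q_notin_RU _ (sE ω) (fun i hi hiA => ?_) hq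
      exact hne ⟨i, hiA, red_imp ω i hi (hAqOut hiA)⟩
    · rintro ⟨i, hi, hiω⟩
      exact q_in_RU _ ⟨i, hi, Finset.mem_union_right _ (Finset.mem_inter.mpr ⟨hiω, hAqOut hi⟩)⟩
  have hyA : ∀ α : Finset ι, α ⊆ Aq → y ∉ RS (τ ∪ α ∩ Out) := by
    intro α hα
    refine y_notin_RS _ (sE α) fun i hi hiB => ?_
    rcases Finset.mem_union.mp hi with h | h
    · exact hτBy i h hiB
    · exact hAqBy i (hα (Finset.mem_inter.mp h).1) hiB
  have hqBy : ∀ β : Finset ι, β ⊆ By → q ∉ RS (τ ∪ β ∩ Out) := by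
    intro β hβ
    refine q_notin_RS _ (sE β) fun i hi hiA => ?_
    rcases Finset.mem_union.mp hi with h | h
    · exact hτAq i h hiA
    · exact hAqBy i hiA (hβ (Finset.mem_inter.mp h).1)
  have hexpl : ∀ α β : Finset ι, α ⊆ Aq → β ⊆ By → y ∉ RS (τ ∪ (α ∪ β) ∩ Out) → RS (τ ∪ (α ∪ β) ∩ Out) = RS (τ ∪ α ∩ Out) := by
    intro α β hα hβ hy
    have h1 : (α ∪ β) ∩ Out = α ∪ β := Finset.inter_eq_left.mpr (Finset.union_subset (hα.trans hAqOut) (hβ.trans hByOut))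
    have h2 : α ∩ Out = α := Finset.inter_eq_left.mpr (hα.trans hAqOut)
    rw [h1, ← Finset.union_assoc] at hy ⊢
    rw [h2]
    exact setCluster_union_eq_of_not_mem ends S (fun j hj => (endsBy j (hβ hj)).imp fun u hu => hu.2) hy
  have hR0 : RS (τ ∪ ∅ ∩ Out) ⊆ ↑U := by
    rw [Finset.empty_inter, Finset.union_empty]
    exact RS_sub_U τ hτE hτAq hτBy
  have hcore := rcset_row_two_core_nonadj Aq By hdisj hAqne hByne U y q hyq hyU hqU memU f g hf hg
    (fun ω => RS (τ ∪ ω ∩ Out)) (fun ω => RU (τ ∪ ω ∩ Out)) (fun ω => RU (E \ (τ ∪ ω ∩ Out)))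
    (fun ω => hUsubRU _) (fun ω => hUsubRU _)
    (fun ω ω' h => setCluster_mono ends S (Finset.union_subset_union subset_rfl (Finset.inter_subset_inter_right h)))
    hR0 hyB hqB hyP hqP hyA hqBy hexpl
  refine hcore.trans_eq (Finset.sum_congr rfl fun ω hω => ?_)
  have hωO : τ ∪ ω ∩ Out = τ ∪ ω := by rw [Finset.inter_eq_left.mpr (Finset.mem_powerset.mp hω)]
  simp only [hωO]
  congr 2

end Coefficientwise

end Summit.CriticalPhenomena.PercolationContinuityZ3.Theorems
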